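import Summits.QuantumFields.BalabanUV.T4Continuum.Support.BlockAverageLoopFlux
import Summits.QuantumFields.BalabanUV.T4Continuum.Support.SmoothRefineBlocks
import HarnessLib

/-!
# T⁴ programme, node NE3 — NO-GO for k-uniform tangent coercivity in the unit-scale energy norm, part 1:
# contour sums of PROFILE cochains and of EXACT cochains along Bałaban's contours `Γ_{c,x}` (pure lattice bookkeeping)

NE3 prover lineage P1, gen 19 (cell `pub-balaban`, unit `b2b-balaban-t4-ne3-p1`, row NE3 OWNER); located error G-ne3p1-g19-1
(HOME/GAPS.md): the energy-convexity road's leaf L5 «tangent coercivity with a k-free constant in the unit-scale energy norm» is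
refuted at the flat background by an explicit tangent direction.  This file supplies the word-level bookkeeping for that witness:
for a PROFILE cochain `prof i₀ i₁ g` (supported on the bonds of direction `i₀`, value `g(x_{i₁})` depending on ONE other coordinate)
and an EXACT cochain `dPot Φ` (`Φ(x + e_μ) − Φ(x)`) it computes the abelian contour functional `asum` of `B7Prop1Explicit` over
segments, tree contours (`treeWord`, spelled in the order `d−1, …, 1, 0` — direction `i₀ = 0` LAST) and the contours `Γ_{c,x}`
(`gammaWord`) of the block average (42), and the first-order term `Tside` ((47): `Σ_{x∈B(c₋)} L^{−d} A(Γ_{c,x})`) at the three kinds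
of coarse bonds: parallel to the support direction (block SUM of the profile), parallel to the profile direction (a COARSE GRADIENT
of the block sum, weight `(L−1)/(2L)` — the tree contours at the two corners see shifted profiles), any other direction (`0`).

CONTENT (2 defs = the two cochain shapes, 0 sorry): §1 sums over the block `Fin d → Fin L` of functions of one or two
coordinates; §2 `dPot`, `asum_dPot`, `Tside_dPot`; §3 `prof`, `asum_prof_seg_self∕_other`, `asum_prof_treeWord`; §4
`Tside_prof_self`, `Tside_prof_profileDir`, `Tside_prof_other`.

HONEST FRAMING.  Lattice combinatorics only (our frame; B7 (42)∕(47) are definitions in the tree); nothing about minimisers, T-E,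
(H∃) or NE3 is asserted; NE3 NOT proved; spine 0∕9; finite T⁴ rung (B)+1 — NOT infinite volume, NOT mass gap, NOT Clay.
PLACEMENT: `Summits/QuantumFields/BalabanUV/`.
-/

set_option autoImplicit false

open scoped BigOperators
open Finset

namespace Summit.QuantumFields.BalabanUV.T4Continuum.NE3TangentNoGoWords

open Literature.MathematicalPhysics.QuantumFieldTheory.Balaban1983to89
open B7Prop1Explicit
open BlockAverageLoopFlux (upper upper_zero upper_apply_of_le upper_apply_of_lt treeWord_upper_succ)
open SmoothRefineBlocks (steps mem_steps_treeWord asum_eq_zero_of_steps)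

noncomputable section

variable {d : ℕ}

/-! ## §1 Sums over the block `Fin d → Fin L` of functions of one or two coordinates -/

/-- `Σ_{r ∈ [0,L)^{m+1}} φ(r_i) = L^m · Σ_{t<L} φ(t)`. [folklore] -/
theorem sum_coord {M : Type*} [AddCommMonoid M] (m L : ℕ) (i : Fin (m + 1)) (φ : Fin L → M) :
    ∑ r : Fin (m + 1) → Fin L, φ (r i) = L ^ m • ∑ t : Fin L, φ t := by
  rw [Fintype.sum_equiv (Fin.insertNthEquiv (fun _ => Fin L) i).symm (fun r => φ (r i)) (fun p => φ p.1)
      (fun r => by simp), Fintype.sum_prod_type]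
  simp only [sum_const, card_univ, Fintype.card_fun, Fintype.card_fin]
  rw [smul_sum]

/-- `Σ_{r ∈ [0,L)^{m+2}} a(r_i) • b(r_j) = L^m · (Σ_t a t) • (Σ_s b s)` for `i ≠ j`. [folklore] -/
theorem sum_two_coord {M : Type*} [AddCommMonoid M] [Module ℝ M] (m L : ℕ) {i j : Fin (m + 2)} (hij : i ≠ j)
    (a : Fin L → ℝ) (b : Fin L → M) :
    ∑ r : Fin (m + 2) → Fin L, a (r i) • b (r j) = L ^ m • ((∑ t : Fin L, a t) • ∑ s : Fin L, b s) := by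
  obtain ⟨j', hj'⟩ := Fin.exists_succAbove_eq hij.symm
  rw [Fintype.sum_equiv (Fin.insertNthEquiv (fun _ => Fin L) i).symm (fun r => a (r i) • b (r j))
      (fun p => a p.1 • b (p.2 j')) (fun r => by simp [Fin.removeNth, hj']), Fintype.sum_prod_type]
  simp only
  simp_rw [← smul_sum, sum_coord m L j' b]
  rw [← sum_smul, smul_comm (∑ t : Fin L, a t) (L ^ m) (∑ s : Fin L, b s)]

/-- `Σ_{t<L} t = L(L−1)/2` in `ℝ`. [folklore] -/
theorem sum_fin_val_eq (L : ℕ) : ∑ t : Fin L, ((t : ℕ) : ℝ) = (L : ℝ) * ((L : ℝ) - 1) / 2 := by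
  rw [Fin.sum_univ_eq_sum_range (fun i => ((i : ℕ) : ℝ)) L]
  have h := Finset.sum_range_id_mul_two L
  rcases Nat.eq_zero_or_pos L with hL | hL
  · subst hL; simp
  · have h2 : (∑ i ∈ range L, (i : ℝ)) * 2 = (L : ℝ) * ((L : ℝ) - 1) := by
      have := congrArg (fun n : ℕ => (n : ℝ)) h
      push_cast [Nat.cast_sub hL] at this
      linarith
    linarith

/-! ## §2 Exact cochains -/

section Exact

variable {X : Type*} [NormedRing X]

/-- THE EXACT COCHAIN (coboundary of a 0-cochain): `dPot Φ (x, μ) := Φ(x + e_μ) − Φ(x)`. [folklore] -/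
def dPot (Φ : Site d → X) : Site d → Fin d → X := fun x μ => Φ (x + e μ) - Φ x

/-- **The contour sum of an exact cochain is the potential difference of the end points**:
`asum (dPot Φ) x w = Φ(x + disp w) − Φ(x)` for EVERY word `w`. [folklore] -/
theorem asum_dPot (Φ : Site d → X) : ∀ (x : Site d) (w : List (Letter d)), asum (dPot Φ) x w = Φ (x + disp w) - Φ x
  | x, [] => by simp
  | x, (μ, true) :: w => by
      rw [asum_cons, stepA_true, Letter.vec_true, asum_dPot Φ (x + e μ) w, disp_cons, Letter.vec_true, ← add_assoc]
      unfold dPot; abel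
  | x, (μ, false) :: w => by
      rw [asum_cons, stepA_false, Letter.vec_false, asum_dPot Φ (x + -e μ) w, disp_cons, Letter.vec_false, ← add_assoc]
      unfold dPot
      rw [show x - e μ + e μ = x by abel, show x - e μ = x + -e μ from sub_eq_add_neg x (e μ)]
      abel

/-- … in particular over the contour `Γ_{c,x}` of the coarse bond `c = ⟨q, q + Le_κ⟩`: `Φ(q + Le_κ) − Φ(q)`, independent of
the block point `x`. [folklore] -/
theorem asum_dPot_gammaWord (L : ℕ) (Φ : Site d → X) (q : Site d) (κ : Fin d) (r : Site d) :
    asum (dPot Φ) q (gammaWord L κ r) = Φ (q + (L : ℤ) • e κ) - Φ q := by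
  rw [asum_dPot, disp_gammaWord]

end Exact

/-! ## §3 Profile cochains -/

section Profile

variable {X : Type*} [NormedRing X]

/-- THE PROFILE COCHAIN: supported on the bonds of direction `i₀`, with value `g(x_{i₁})` depending on the coordinate `i₁`
only. [folklore] -/
def prof (i₀ i₁ : Fin d) (g : ℤ → X) : Site d → Fin d → X := fun x μ => if μ = i₀ then g (x i₁) else 0

variable {i₀ i₁ : Fin d}

omit [NormedRing X] in
/-- Moving along `e_κ`, `κ ≠ i₁`, does not change the coordinate `i₁`. [folklore] -/
theorem coord_add_zsmul_e_of_ne {κ : Fin d} (hκ : κ ≠ i₁) (x : Site d) (t : ℤ) : (x + t • e κ) i₁ = x i₁ := by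
  simp [e_apply, Ne.symm hκ]

/-- Along a segment in the support direction the profile is summed `n` times at the same argument:
`asum (prof i₀ i₁ g) y (seg i₀ n) = n • g(y_{i₁})` (`i₀ ≠ i₁`). [folklore] -/
theorem asum_prof_seg_self (h01 : i₀ ≠ i₁) (g : ℤ → X) (y : Site d) (n : ℕ) :
    asum (prof i₀ i₁ g) y (seg i₀ (n : ℤ)) = n • g (y i₁) := by
  rw [asum_seg_natCast]
  have : ∀ i ∈ range n, prof i₀ i₁ g (y + (i : ℤ) • e i₀) i₀ = g (y i₁) := by
    intro i _
    simp [prof, e_apply, Ne.symm h01]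
  rw [sum_congr rfl this, sum_const, card_range]

/-- Along a segment in any other direction the profile cochain contributes nothing. [folklore] -/
theorem asum_prof_seg_other (g : ℤ → X) (y : Site d) {κ : Fin d} (hκ : κ ≠ i₀) (n : ℕ) :
    asum (prof i₀ i₁ g) y (seg κ (n : ℤ)) = 0 := by
  rw [asum_seg_natCast]
  exact sum_eq_zero fun i _ => by simp [prof, hκ]

/-- **The profile cochain along a tree contour** `Γ_{x, x+v}` (`v ≥ 0`; directions spelled `d−1, …, 1, 0`, so the `i₀ = 0`
letters come LAST, after the coordinate `i₁` has been completed): `asum (prof i₀ i₁ g) x (treeWord v) = v_{i₀} • g(x_{i₁} + v_{i₁})`.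
[folklore] -/
theorem asum_prof_treeWord (h0 : (i₀ : ℕ) = 0) (h01 : i₀ ≠ i₁) (g : ℤ → X) (x v : Site d) (hv : ∀ κ, 0 ≤ v κ) :
    asum (prof i₀ i₁ g) x (treeWord v) = (v i₀).toNat • g (x i₁ + v i₁) := by
  have hsplit : treeWord v = treeWord (upper ((i₀ : ℕ) + 1) v) ++ seg i₀ (v i₀) := by
    have h := treeWord_upper_succ i₀ v
    rw [h0] at h ⊢
    rw [upper_zero] at h
    exact h
  have hup0 : ∀ κ, 0 ≤ upper ((i₀ : ℕ) + 1) v κ := by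
    intro κ
    by_cases hκ : (i₀ : ℕ) + 1 ≤ (κ : ℕ)
    · rw [upper_apply_of_le v hκ]; exact hv κ
    · rw [upper_apply_of_lt v (not_le.mp hκ)]
  have htree : asum (prof i₀ i₁ g) x (treeWord (upper ((i₀ : ℕ) + 1) v)) = 0 := by
    refine asum_eq_zero_of_steps _ _ _ fun s hs => ?_
    obtain ⟨y, κ, rfl, hxy, hyv⟩ := mem_steps_treeWord x _ hup0 s hs
    have hκ : κ ≠ i₀ := by
      intro hκ0
      have h1 : (y + e κ) i₀ ≤ (x + upper ((i₀ : ℕ) + 1) v) i₀ := hyv i₀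
      have h2 : x i₀ ≤ y i₀ := hxy i₀
      have he : e κ i₀ = 1 := by rw [e_apply, if_pos hκ0.symm]
      have hu : upper ((i₀ : ℕ) + 1) v i₀ = 0 := upper_apply_of_lt v (Nat.lt_succ_self _)
      rw [Pi.add_apply, Pi.add_apply, he, hu] at h1
      omega
    simp [stepA_true, prof, hκ]
  have hi1 : upper ((i₀ : ℕ) + 1) v i₁ = v i₁ := by
    refine upper_apply_of_le v ?_
    have : (i₁ : ℕ) ≠ (i₀ : ℕ) := fun h => h01 (Fin.ext h.symm)
    omega
  obtain ⟨m, hm⟩ := Int.eq_ofNat_of_zero_le (hv i₀)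
  rw [hsplit, asum_append, htree, zero_add, disp_treeWord, hm, asum_prof_seg_self h01, Int.toNat_natCast, Pi.add_apply,
    hi1]

/-- The profile cochain along the contour `Γ_{c,x}` of a coarse bond `c = ⟨q, q + Le_κ⟩`, block point `x = q + r`
(`r ∈ [0,L)^d`): tree contour in, segment, tree contour out (B7 (14), `asum_gammaWord`). [folklore] -/
theorem asum_prof_gammaWord (h0 : (i₀ : ℕ) = 0) (h01 : i₀ ≠ i₁) (L : ℕ) (g : ℤ → X) (q : Site d) (κ : Fin d)
    (r : Fin d → Fin L) :
    asum (prof i₀ i₁ g) q (gammaWord L κ (boxVec L r)) =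
      (r i₀ : ℕ) • g (q i₁ + (r i₁ : ℕ)) + asum (prof i₀ i₁ g) (q + boxVec L r) (seg κ (L : ℤ))
        - (r i₀ : ℕ) • g ((q + (L : ℤ) • e κ) i₁ + (r i₁ : ℕ)) := by
  have hv : ∀ μ, (0 : ℤ) ≤ boxVec L r μ := fun μ => by simp [boxVec]
  have ht : ∀ μ, (boxVec L r μ).toNat = (r μ : ℕ) := fun μ => by simp [boxVec]
  rw [asum_gammaWord, asum_prof_treeWord h0 h01 g q _ hv, asum_prof_treeWord h0 h01 g _ _ hv, ht]
  simp only [boxVec]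

end Profile

/-! ## §4 The first-order term `Tside` ((47)) of profile and exact cochains at the three kinds of coarse bonds -/

section TsideLemmas

variable {X : Type*} [NormedRing X] [NormedAlgebra ℂ X]
variable {i₀ i₁ : Fin d}

/-- The block sum of a profile along the profile coordinate: `(S g)(w) := Σ_{t<L} g(Lw + t)`. [folklore] -/
def bsum (L : ℕ) (g : ℤ → X) (w : ℤ) : X := ∑ t : Fin L, g ((L : ℤ) * w + (t : ℕ))

/-- **COARSE BONDS PARALLEL TO THE SUPPORT DIRECTION**: the tree contours cancel and the segment sums the profile:
`Tside L (prof i₀ i₁ g) (L•z) i₀ = (S g)(z_{i₁})` (for `d = m + 1 ≥ 2`, `L ≥ 1`). [folklore] -/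
theorem Tside_prof_self {m : ℕ} {i₀ i₁ : Fin (m + 1)} (h0 : (i₀ : ℕ) = 0) (h01 : i₀ ≠ i₁) (L : ℕ) (hL : 1 ≤ L)
    (g : ℤ → X) (z : Site (m + 1)) :
    Tside L (prof i₀ i₁ g) ((L : ℤ) • z) i₀ = bsum L g (z i₁) := by
  have hL0 : (L : ℝ) ≠ 0 := by exact_mod_cast (by omega : L ≠ 0)
  unfold Tside
  have hterm : ∀ r : Fin (m + 1) → Fin L,
      asum (prof i₀ i₁ g) ((L : ℤ) • z) (gammaWord L i₀ (boxVec L r)) = (L : ℕ) • g ((L : ℤ) * z i₁ + (r i₁ : ℕ)) := by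
    intro r
    rw [asum_prof_gammaWord h0 h01, coord_add_zsmul_e_of_ne h01, add_sub_cancel_left, asum_prof_seg_self h01]
    congr 2
  simp_rw [hterm]
  rw [← smul_sum, sum_coord m L i₁ (fun t => (L : ℕ) • g ((L : ℤ) * z i₁ + (t : ℕ))), ← smul_sum]
  unfold bsum
  rw [← Nat.cast_smul_eq_nsmul ℝ (L ^ m), ← Nat.cast_smul_eq_nsmul ℝ L, smul_smul, smul_smul]
  have : ((L : ℝ) ^ (m + 1))⁻¹ * ((L ^ m : ℕ) : ℝ) * ((L : ℕ) : ℝ) = 1 := by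
    push_cast
    field_simp
    ring
  rw [this, one_smul]

/-- **COARSE BONDS PARALLEL TO THE PROFILE DIRECTION**: the segment contributes nothing and the two tree contours see the
profile at `x_{i₁}` and `x_{i₁} + L`: `Tside L (prof i₀ i₁ g) (L•z) i₁ = −((L−1)/(2L)) • [(S g)(z_{i₁} + 1) − (S g)(z_{i₁})]`
(for `d = m + 2 ≥ 2`). [folklore] -/
theorem Tside_prof_profileDir {m : ℕ} {i₀ i₁ : Fin (m + 2)} (h0 : (i₀ : ℕ) = 0) (h01 : i₀ ≠ i₁) (L : ℕ) (hL : 1 ≤ L)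
    (g : ℤ → X) (z : Site (m + 2)) :
    Tside L (prof i₀ i₁ g) ((L : ℤ) • z) i₁
      = -(((L : ℝ) - 1) / (2 * L)) • (bsum L g (z i₁ + 1) - bsum L g (z i₁)) := by
  have hL0 : (L : ℝ) ≠ 0 := by exact_mod_cast (by omega : L ≠ 0)
  have h10 : i₁ ≠ i₀ := fun h => h01 h.symm
  have hq1 : ((L : ℤ) • z) i₁ = (L : ℤ) * z i₁ := by simp
  have hq2 : ((L : ℤ) • z + (L : ℤ) • e i₁) i₁ = (L : ℤ) * (z i₁ + 1) := by
    simp [e_apply]; ring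
  unfold Tside
  have hterm : ∀ r : Fin (m + 2) → Fin L,
      asum (prof i₀ i₁ g) ((L : ℤ) • z) (gammaWord L i₁ (boxVec L r))
        = ((r i₀ : ℕ) : ℝ) • (g ((L : ℤ) * z i₁ + (r i₁ : ℕ)) - g ((L : ℤ) * (z i₁ + 1) + (r i₁ : ℕ))) := by
    intro r
    rw [asum_prof_gammaWord h0 h01, asum_prof_seg_other g _ h10, add_zero, hq1, hq2, ← Nat.cast_smul_eq_nsmul ℝ,
      ← Nat.cast_smul_eq_nsmul ℝ, ← smul_sub]
  simp_rw [hterm]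
  rw [← smul_sum, sum_two_coord m L h01 (fun t => ((t : ℕ) : ℝ))
    (fun s => g ((L : ℤ) * z i₁ + (s : ℕ)) - g ((L : ℤ) * (z i₁ + 1) + (s : ℕ))), sum_fin_val_eq, sum_sub_distrib]
  unfold bsum
  rw [← Nat.cast_smul_eq_nsmul ℝ (L ^ m), smul_smul, smul_smul, neg_smul, ← smul_neg, neg_sub]
  congr 1
  push_cast
  field_simp
  ring

/-- **ALL OTHER COARSE BONDS**: `Tside L (prof i₀ i₁ g) (L•z) κ = 0` for `κ ∉ {i₀, i₁}`. [folklore] -/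
theorem Tside_prof_other (h0 : (i₀ : ℕ) = 0) (h01 : i₀ ≠ i₁) (L : ℕ) (g : ℤ → X) (z : Site d) {κ : Fin d}
    (hκ0 : κ ≠ i₀) (hκ1 : κ ≠ i₁) : Tside L (prof i₀ i₁ g) ((L : ℤ) • z) κ = 0 := by
  unfold Tside
  refine sum_eq_zero fun r _ => ?_
  rw [asum_prof_gammaWord h0 h01, asum_prof_seg_other g _ hκ0, add_zero, coord_add_zsmul_e_of_ne hκ1, sub_self,
    smul_zero]

/-- **EXACT COCHAINS**: `Tside L (dPot Φ) (L•z) κ = Φ(L•z + Le_κ) − Φ(L•z)` (the weights sum to one). [folklore] -/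
theorem Tside_dPot (L : ℕ) (hL : 1 ≤ L) (Φ : Site d → X) (z : Site d) (κ : Fin d) :
    Tside L (dPot Φ) ((L : ℤ) • z) κ = Φ ((L : ℤ) • z + (L : ℤ) • e κ) - Φ ((L : ℤ) • z) := by
  unfold Tside
  simp_rw [asum_dPot_gammaWord]
  rw [← sum_smul, sum_const, card_univ, Fintype.card_fun, Fintype.card_fin, Fintype.card_fin, nsmul_eq_mul]
  have hL0 : (L : ℝ) ≠ 0 := by exact_mod_cast (by omega : L ≠ 0)
  have : ((L ^ d : ℕ) : ℝ) * ((L : ℝ) ^ d)⁻¹ = 1 := by push_cast; field_simp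
  rw [this, one_smul]

end TsideLemmas

end

end Summit.QuantumFields.BalabanUV.T4Continuum.NE3TangentNoGoWords
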